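import Mathlib
import Literature.Analysis.FluidPDE.GaussianVortexPlanar
import Literature.Analysis.FluidPDE.StretchedLayerNS
import Summits.AnomalousDissipation.AnomalousDissipation.Theorems.MarginalStabilityChainStretchedVortexRowsStubBraidExitPhi
import HarnessLib

/-!
# Stub `stub_braidExit` (r4) of the line `braid-closed-large-circulation-gluing`
# (crux stmt-AnomalousDissipation-3009, `MarginalStabilityChain.StretchedVortexRows`)

EXIT-TIME LYAPUNOV FUNCTION FOR THE FROZEN ROW FIELD AWAY FROM THE SADDLES. For `0 < L ≤ 1` and a
saddle-disc radius `0 < ρ₀ ≤ L/4` we take `C = 1.2·10⁵ L²/ρ₀²`; for `0 < ν ≤ r²`, `0 < r ≤ L/4` the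
witness is `φ = exitPhi L M Λ s₀ k` (part F) with `M = 4·10⁴ L²/ρ₀²`, `Λ = 1 + log(L²/ν)`,
`s₀ = log(1 − cos(2πr/L))`, `k = 10⁻⁵ L/π`:
`φ = M · (Λ log((Λ + log D − s₀)/Λ) + k · sin a sinh b · (10/(10 + D))² + 10k)`,
`a = 2πx/L`, `b = 2πy/L`, `D = cosh b − cos a`.

PROOF (parts A–F, all `--supports 3009`). On the outer domain `Ω` (plane minus the closed core discs
of radius `r` about `Lℤ × {0}` and the closed saddle discs of radius `ρ₀` about `(ℤ+½)L × {0}`):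
`D ≥ 1 − cos(2πr/L) ≥ 8r²/L² ≥ 8ν/L²` on `closure Ω` (part B), so `log D ≥ s₀ ≥ 3 − Λ` and `φ` is
`C²` there (parts A, D, F), periodic, `≥ 0`, and `≤ 3MΛ(1 + log(1 + |y|/L))` (part F). The operator:
the Leibniz expansion (part D) and the exact identities `𝒜G(log D) = ν(2π/L)²(E/D)G″ − G′ b sinh b/D`
(part A), `𝒜S = (π/L)(cos a sinh²b − sin²a cosh b)/D − b sin a cosh b` (part B), applied also to the
weight `W₀(log D)`, regroup `𝒜φ/M` into the radial part plus `κ`·(five corrector terms) (part E,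
`corrector_regroup`). In the strip `|b| ≤ 1/4`: `≤ −(κ/3)E` (part E `strip_bound`: the cell-layer
mechanism, `G′ ≥ 1/2` there) and `E ≥ 8ρ₀²/L²` off the saddle discs (part F), so `𝒜φ ≤ −16/15`.
For `|b| ≥ 1/4`: the corrector terms are `≤ 200κ = 2·10⁻³` (part E `corrector_far_bound`) while the
radial part is `≤ −G′ b sinh b/(cosh b + 1) ≤ −[Λ/(2Λ + |b|)]·[b²/(2 + |b|)] ≤ −1/81` (parts A, B), and
`M ≥ 6.4·10⁵`, so `𝒜φ ≤ −1`. No input at the saddles is needed: the excised discs are `stub_saddleExit`.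
-/

set_option linter.dupNamespace false

noncomputable section

open scoped BigOperators Topology RealInnerProductSpace ContDiff ENNReal
open Filter Set Function MeasureTheory WithLp

namespace Summit.AnomalousDissipation.AnomalousDissipation.Theorems.MarginalStabilityChainStretchedVortexRows

open Literature.Analysis.FluidPDE Literature.Analysis.FluidPDE.StretchedLayer
open BraidExit

/-- **The supersolution inequality** `νΔφ + U₀·∇φ ≤ −1` for `φ = exitPhi L M Λ s₀ k` with the
parameters of `stub_braidExit`, at every point of the r4 outer domain. [folklore] -/
theorem exitPhi_operator {L : ℝ} (hL : 0 < L) (hL1 : L ≤ 1) {ρ₀ ν r : ℝ} (hρ₀ : 0 < ρ₀)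
    (hρ₀L : ρ₀ ≤ L / 4) (hν : 0 < ν) (hr : 0 < r) (hνr : ν ≤ r ^ 2) (hrL : r ≤ L / 4) {x y : ℝ}
    (hq1 : ∀ n : ℤ, r ^ 2 < (x - n * L) ^ 2 + y ^ 2)
    (hq2 : ∀ n : ℤ, ρ₀ ^ 2 < (x - (n + 1 / 2) * L) ^ 2 + y ^ 2) :
    ν * lap (exitPhi L (40000 * L ^ 2 / ρ₀ ^ 2) (1 + Real.log (L ^ 2 / ν))
        (Real.log (1 - Real.cos (2 * Real.pi * r / L))) (1 / 100000 * (L / Real.pi))) x y +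
      Real.sinh (2 * Real.pi * y / L) /
          (2 * (Real.cosh (2 * Real.pi * y / L) - Real.cos (2 * Real.pi * x / L))) *
        dX (exitPhi L (40000 * L ^ 2 / ρ₀ ^ 2) (1 + Real.log (L ^ 2 / ν))
          (Real.log (1 - Real.cos (2 * Real.pi * r / L))) (1 / 100000 * (L / Real.pi))) x y +
      (-(Real.sin (2 * Real.pi * x / L) /
          (2 * (Real.cosh (2 * Real.pi * y / L) - Real.cos (2 * Real.pi * x / L)))) - y) *
        dY (exitPhi L (40000 * L ^ 2 / ρ₀ ^ 2) (1 + Real.log (L ^ 2 / ν))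
          (Real.log (1 - Real.cos (2 * Real.pi * r / L))) (1 / 100000 * (L / Real.pi))) x y ≤ -1 := by
  obtain ⟨hΛ, hDr, hs₀, hτ⟩ := exit_params hL hL1 hν hr hνr hrL
  set Λ := 1 + Real.log (L ^ 2 / ν) with hΛdef
  set s₀ := Real.log (1 - Real.cos (2 * Real.pi * r / L)) with hs₀def
  set M := 40000 * L ^ 2 / ρ₀ ^ 2 with hMdef
  have hπ := Real.pi_pos
  have hD : 0 < rowD L x y := rowD_pos_of_forall hL.ne' hr fun n => (hq1 n).le
  have hDge : 1 - Real.cos (2 * Real.pi * r / L) ≤ rowD L x y :=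
    cosh_sub_cos_ge_of_forall hL hr hrL fun n => (hq1 n).le
  have hDr0 : 0 < 1 - Real.cos (2 * Real.pi * r / L) := lt_of_lt_of_le (by positivity) hDr
  have hℓ : s₀ ≤ Real.log (rowD L x y) := Real.log_le_log hDr0 hDge
  have hℓU : Real.log (rowD L x y) ∈ Ioi (s₀ - Λ) := by simp only [mem_Ioi]; linarith
  have hE : 8 * ρ₀ ^ 2 / L ^ 2 ≤ rowE L x y := rowE_ge_of_forall_saddle hL fun n => (hq2 n).le
  have hM16 : 640000 ≤ M := by
    rw [hMdef, le_div_iff₀ (by positivity)]; nlinarith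
  have hM0 : 0 < M := by linarith
  -- derivative data of the two profiles
  have hG : ∀ s ∈ Ioi (s₀ - Λ), HasDerivAt (logProfile Λ s₀) ((fun s => Λ / (Λ + s - s₀)) s) s :=
    fun s hs => hasDerivAt_logProfile Λ s₀ hs
  have hG' : ∀ s ∈ Ioi (s₀ - Λ), HasDerivAt (fun s => Λ / (Λ + s - s₀))
      ((fun s => -Λ / (Λ + s - s₀) ^ 2) s) s :=
    fun s hs => hasDerivAt_deriv_logProfile Λ s₀ hs
  have hW : ∀ s ∈ (univ : Set ℝ), HasDerivAt decayProfile
      ((fun s => -200 * Real.exp s / (10 + Real.exp s) ^ 3) s) s :=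
    fun s _ => hasDerivAt_decayProfile s
  have hW' : ∀ s ∈ (univ : Set ℝ), HasDerivAt (fun s => -200 * Real.exp s / (10 + Real.exp s) ^ 3)
      ((fun s => -200 * Real.exp s * (10 - 2 * Real.exp s) / (10 + Real.exp s) ^ 4) s) s :=
    fun s _ => hasDerivAt_deriv_decayProfile s
  -- Leibniz expansion
  have hexp := rowOperator_comb (M := M) (k := 1 / 100000 * (L / Real.pi))
    (c₀ := 10 * (1 / 100000 * (L / Real.pi))) (f := radialLayer L (logProfile Λ s₀)) (g := rowS L)
    (h := radialLayer L decayProfile) (x := x) (y := y)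
    (eventually_differentiableAt_radialLayer_fst isOpen_Ioi hG hD hℓU)
    (eventually_differentiableAt_rowS_fst L x y)
    (eventually_differentiableAt_radialLayer_fst isOpen_univ hW hD (mem_univ _))
    (differentiableAt_dX_radialLayer isOpen_Ioi hG hG' hD hℓU) (differentiableAt_dX_rowS L x y)
    (differentiableAt_dX_radialLayer isOpen_univ hW hW' hD (mem_univ _))
    (eventually_differentiableAt_radialLayer_snd isOpen_Ioi hG hD hℓU)
    (eventually_differentiableAt_rowS_snd L x y)
    (eventually_differentiableAt_radialLayer_snd isOpen_univ hW hD (mem_univ _))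
    (differentiableAt_dY_radialLayer isOpen_Ioi hG hG' hD hℓU) (differentiableAt_dY_rowS L x y)
    (differentiableAt_dY_radialLayer isOpen_univ hW hW' hD (mem_univ _)) ν
    (Real.sinh (2 * Real.pi * y / L) /
      (2 * (Real.cosh (2 * Real.pi * y / L) - Real.cos (2 * Real.pi * x / L))))
    (-(Real.sin (2 * Real.pi * x / L) /
      (2 * (Real.cosh (2 * Real.pi * y / L) - Real.cos (2 * Real.pi * x / L)))) - y)
  unfold exitPhi
  rw [hexp, rowOperator_radialLayer isOpen_Ioi hG hG' ν hD hℓU]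
  -- regroup the corrector terms
  have hreg := corrector_regroup (ν := ν) (b := 2 * Real.pi * y / L) (A := Real.cos (2 * Real.pi * x / L))
    (Sa := Real.sin (2 * Real.pi * x / L)) (B := Real.cosh (2 * Real.pi * y / L))
    (Sb := Real.sinh (2 * Real.pi * y / L)) (D := rowD L x y) (E := rowE L x y) (Z := 10 + rowD L x y)
    (hv := radialLayer L decayProfile x y)
    (W₁ := (fun s => -200 * Real.exp s / (10 + Real.exp s) ^ 3) (Real.log (rowD L x y)))
    (W₂ := (fun s => -200 * Real.exp s * (10 - 2 * Real.exp s) / (10 + Real.exp s) ^ 4)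
      (Real.log (rowD L x y)))
    (Tg := ν * lap (rowS L) x y + Real.sinh (2 * Real.pi * y / L) /
        (2 * (Real.cosh (2 * Real.pi * y / L) - Real.cos (2 * Real.pi * x / L))) * dX (rowS L) x y +
      (-(Real.sin (2 * Real.pi * x / L) /
        (2 * (Real.cosh (2 * Real.pi * y / L) - Real.cos (2 * Real.pi * x / L)))) - y) * dY (rowS L) x y)
    (Th := ν * lap (radialLayer L decayProfile) x y + Real.sinh (2 * Real.pi * y / L) /
        (2 * (Real.cosh (2 * Real.pi * y / L) - Real.cos (2 * Real.pi * x / L))) *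
          dX (radialLayer L decayProfile) x y +
      (-(Real.sin (2 * Real.pi * x / L) /
        (2 * (Real.cosh (2 * Real.pi * y / L) - Real.cos (2 * Real.pi * x / L)))) - y) *
          dY (radialLayer L decayProfile) x y)
    (Xg := dX (rowS L) x y) (Yg := dY (rowS L) x y) (Xh := dX (radialLayer L decayProfile) x y)
    (Yh := dY (radialLayer L decayProfile) x y)
    hL rfl (Real.sin_sq_add_cos_sq _) (Real.sinh_sq _) rfl rfl hD rfl (radialLayer_decayProfile hD)
    (by show -200 * Real.exp (Real.log (rowD L x y)) / (10 + Real.exp (Real.log (rowD L x y))) ^ 3 = _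
        rw [Real.exp_log hD])
    (by show -200 * Real.exp (Real.log (rowD L x y)) * (10 - 2 * Real.exp (Real.log (rowD L x y))) /
          (10 + Real.exp (Real.log (rowD L x y))) ^ 4 = _
        rw [Real.exp_log hD])
    (rowOperator_rowS ν L x y) (rowOperator_radialLayer isOpen_univ hW hW' ν hD (mem_univ _))
    (by rw [dX_rowS]) (by rw [dY_rowS]) (dX_radialLayer hW hD (mem_univ _))
    (dY_radialLayer hW hD (mem_univ _))
  rw [show rowS L x y = Real.sin (2 * Real.pi * x / L) * Real.sinh (2 * Real.pi * y / L) from rfl,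
    mul_assoc (1 / 100000 : ℝ) (L / Real.pi), hreg]
  clear hexp hreg
  -- the two regimes
  set b := 2 * Real.pi * y / L with hb
  set ℓ := Real.log (rowD L x y) with hℓdef
  have hβ : 0 ≤ b * Real.sinh b := mul_sinh_nonneg' hL y
  have hB1 : 1 ≤ Real.cosh b := Real.one_le_cosh b
  have hG₂ : (fun s => -Λ / (Λ + s - s₀) ^ 2) ℓ ≤ 0 := by
    show -Λ / (Λ + ℓ - s₀) ^ 2 ≤ 0
    exact div_nonpos_of_nonpos_of_nonneg (by linarith) (sq_nonneg _)
  have hden : 0 < Λ + ℓ - s₀ := by linarith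
  have hℓle : ℓ ≤ |b| + 1 :=
    (Real.log_le_log hD (rowD_le L x y)).trans (log_cosh_add_one_le b)
  by_cases hstrip : |b| ≤ 1 / 4
  · -- the strip: cell-layer mechanism
    obtain ⟨hBle, hSb⟩ := strip_hyp hstrip
    have hG₁ : 1 / 2 ≤ (fun s => Λ / (Λ + s - s₀)) ℓ := by
      show 1 / 2 ≤ Λ / (Λ + ℓ - s₀)
      have hℓ1 : ℓ ≤ 1 := by
        have h1 : rowD L x y ≤ Real.cosh b + 1 := rowD_le L x y
        have h2 : Real.log (rowD L x y) ≤ Real.log (Real.exp 1) :=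
          Real.log_le_log hD (by linarith [Real.exp_one_gt_d9])
        rwa [Real.log_exp] at h2
      rw [div_le_div_iff₀ (by norm_num) hden]; linarith only [hℓ1, hs₀, hΛ]
    have hs := strip_bound (c := 2 * Real.pi / L) (κ := 1 / 100000)
      (G₁ := (fun s => Λ / (Λ + s - s₀)) ℓ) (G₂ := (fun s => -Λ / (Λ + s - s₀) ^ 2) ℓ) hL hL1 hν.le hτ
      (Real.sin_sq_add_cos_sq _) hSb hB1 hBle (sq_div_two_le_cosh_sub_one b)
      (cosh_sub_one_le_half_mul_sinh b) hβ (rfl : rowD L x y = _) (rfl : rowE L x y = _) hD rfl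
      (radialLayer_decayProfile hD) (by norm_num) (by norm_num) hG₁ hG₂
    have hkey : M * (1 / 100000 / 3) * (8 * ρ₀ ^ 2 / L ^ 2) = 16 / 15 := by
      rw [hMdef]; field_simp; ring
    have key : ∀ X : ℝ, X ≤ -(1 / 100000 / 3) * rowE L x y → M * X ≤ -1 := by
      intro X hX
      have h1 := mul_le_mul_of_nonneg_left hX hM0.le
      have h2 := mul_le_mul_of_nonneg_left hE hM0.le
      linarith only [h1, h2, hkey]
    exact key _ hs
  · -- the far region: radial layer dominates the bounded corrector
    have hb4 : 1 / 4 < |b| := lt_of_not_ge hstrip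
    have hbB : |b| ≤ Real.cosh b := by
      rw [← Real.cosh_abs]
      exact (Real.self_le_sinh_iff.2 (abs_nonneg b)).trans (Real.sinh_lt_cosh _).le
    have hfar := corrector_far_bound hL hL1 hν.le hτ (Real.sin_sq_add_cos_sq _) (Real.sinh_sq _) hB1
      hbB (rfl : rowD L x y = _) (rfl : rowE L x y = _) hD rfl (radialLayer_decayProfile hD)
    have hG₁0 : 0 ≤ (fun s => Λ / (Λ + s - s₀)) ℓ := by
      show 0 ≤ Λ / (Λ + ℓ - s₀); positivity
    have hG₁ge : 1 / (2 + |b|) ≤ (fun s => Λ / (Λ + s - s₀)) ℓ := by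
      show 1 / (2 + |b|) ≤ Λ / (Λ + ℓ - s₀)
      rw [div_le_div_iff₀ (by positivity) hden]
      nlinarith only [hℓle, hs₀, hΛ, abs_nonneg b, mul_le_mul_of_nonneg_right hΛ (abs_nonneg b)]
    have hrad1 : ν * (2 * Real.pi / L) ^ 2 * (rowE L x y / rowD L x y) *
        (fun s => -Λ / (Λ + s - s₀) ^ 2) ℓ ≤ 0 :=
      mul_nonpos_of_nonneg_of_nonpos
        (mul_nonneg (mul_nonneg hν.le (sq_nonneg _)) (div_nonneg (rowE_nonneg L x y) hD.le)) hG₂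
    have hrad2 : (fun s => Λ / (Λ + s - s₀)) ℓ * (b * Real.sinh b / (Real.cosh b + 1)) ≤
        (fun s => Λ / (Λ + s - s₀)) ℓ * (b * Real.sinh b / rowD L x y) :=
      mul_le_mul_of_nonneg_left (div_le_div_of_nonneg_left hβ hD (rowD_le L x y)) hG₁0
    have hlow : 1 / 81 ≤ (fun s => Λ / (Λ + s - s₀)) ℓ * (b * Real.sinh b / (Real.cosh b + 1)) := by
      have h1 := sq_div_le_mul_sinh_div b
      have h2 : 1 / (2 + |b|) * (b ^ 2 / (2 + |b|)) ≤
          (fun s => Λ / (Λ + s - s₀)) ℓ * (b * Real.sinh b / (Real.cosh b + 1)) :=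
        mul_le_mul hG₁ge h1 (by positivity) hG₁0
      have h3 : 1 / 81 ≤ 1 / (2 + |b|) * (b ^ 2 / (2 + |b|)) := by
        rw [div_mul_div_comm, one_mul, le_div_iff₀ (by positivity)]
        have h4 : 0 ≤ (4 * |b| - 1) * (5 * |b| + 1) :=
          mul_nonneg (by linarith only [hb4]) (by linarith only [abs_nonneg b])
        nlinarith only [sq_abs b, h4]
      linarith only [h2, h3]
    have key : ∀ X : ℝ, X ≤ -(1 / 100) → M * X ≤ -1 := by
      intro X hX
      have h1 := mul_le_mul_of_nonneg_left hX hM0.le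
      linarith only [h1, hM16]
    refine key _ ?_
    linarith only [hrad1, hrad2, hlow, hfar]

/-- **Stub 3 (r4) — BRAID EXIT away from the saddles.** For `0 < L ≤ 1` and `0 < ρ₀ ≤ L/4` there is
`C = 1.2·10⁵ L²/ρ₀²` such that for `0 < ν ≤ r²`, `0 < r ≤ L/4` the explicit function
`φ = exitPhi L (4·10⁴L²/ρ₀²) (1 + log(L²/ν)) (log(1 − cos(2πr/L))) (10⁻⁵L/π)` is `C²` on the outer
domain (plane minus the closed core discs of radius `r` about `Lℤ × {0}` and the closed saddle discs of
radius `ρ₀` about `(ℤ+½)L × {0}`), continuous and `≥ 0` on its closure, `L`-periodic, satisfies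
`νΔφ + U₀·∇φ ≤ −1` there for the frozen row field `U₀ = (sinh b/(2D), −sin a/(2D) − y)`, and
`φ ≤ C(1 + log(L²/ν))(1 + log(1 + |y|/L))` (module docstring; parts A–F). [folklore] -/
theorem stub_braidExit :
    ∀ L : ℝ, 0 < L → L ≤ 1 → ∀ ρ₀ : ℝ, 0 < ρ₀ → ρ₀ ≤ L / 4 → ∃ C : ℝ, 0 < C ∧
      ∀ ν r : ℝ, 0 < ν → 0 < r → ν ≤ r ^ 2 → r ≤ L / 4 →
      ∃ φ : ℝ → ℝ → ℝ,
        ContDiffOn ℝ 2 (fun q : ℝ × ℝ => φ q.1 q.2)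
          {q : ℝ × ℝ | (∀ n : ℤ, r ^ 2 < (q.1 - n * L) ^ 2 + q.2 ^ 2) ∧ ∀ n : ℤ, ρ₀ ^ 2 < (q.1 - (n + 1 / 2) * L) ^ 2 + q.2 ^ 2} ∧
        ContinuousOn (fun q : ℝ × ℝ => φ q.1 q.2)
          (closure {q : ℝ × ℝ | (∀ n : ℤ, r ^ 2 < (q.1 - n * L) ^ 2 + q.2 ^ 2) ∧ ∀ n : ℤ, ρ₀ ^ 2 < (q.1 - (n + 1 / 2) * L) ^ 2 + q.2 ^ 2}) ∧
        (∀ x y, φ (x + L) y = φ x y) ∧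
        (∀ q ∈ closure {q : ℝ × ℝ | (∀ n : ℤ, r ^ 2 < (q.1 - n * L) ^ 2 + q.2 ^ 2) ∧ ∀ n : ℤ, ρ₀ ^ 2 < (q.1 - (n + 1 / 2) * L) ^ 2 + q.2 ^ 2},
          0 ≤ φ q.1 q.2) ∧
        (∀ q ∈ {q : ℝ × ℝ | (∀ n : ℤ, r ^ 2 < (q.1 - n * L) ^ 2 + q.2 ^ 2) ∧ ∀ n : ℤ, ρ₀ ^ 2 < (q.1 - (n + 1 / 2) * L) ^ 2 + q.2 ^ 2},
          ν * lap φ q.1 q.2 +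
            Real.sinh (2 * Real.pi * q.2 / L) /
                (2 * (Real.cosh (2 * Real.pi * q.2 / L) - Real.cos (2 * Real.pi * q.1 / L))) * dX φ q.1 q.2 +
            (-(Real.sin (2 * Real.pi * q.1 / L) /
                (2 * (Real.cosh (2 * Real.pi * q.2 / L) - Real.cos (2 * Real.pi * q.1 / L)))) - q.2) * dY φ q.1 q.2 ≤ -1) ∧
        (∀ q ∈ {q : ℝ × ℝ | (∀ n : ℤ, r ^ 2 < (q.1 - n * L) ^ 2 + q.2 ^ 2) ∧ ∀ n : ℤ, ρ₀ ^ 2 < (q.1 - (n + 1 / 2) * L) ^ 2 + q.2 ^ 2},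
          φ q.1 q.2 ≤ C * (1 + Real.log (L ^ 2 / ν)) * (1 + Real.log (1 + |q.2| / L))) := by
  intro L hL hL1 ρ₀ hρ₀ hρ₀L
  refine ⟨120000 * L ^ 2 / ρ₀ ^ 2, by positivity, ?_⟩
  intro ν r hν hr hνr hrL
  obtain ⟨hΛ, hDr, hs₀, hτ⟩ := exit_params hL hL1 hν hr hνr hrL
  set Λ := 1 + Real.log (L ^ 2 / ν) with hΛdef
  set s₀ := Real.log (1 - Real.cos (2 * Real.pi * r / L)) with hs₀def
  set M := 40000 * L ^ 2 / ρ₀ ^ 2 with hMdef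
  set k := 1 / 100000 * (L / Real.pi) with hkdef
  have hπ := Real.pi_pos
  have hπ3 : (3 : ℝ) < Real.pi := Real.pi_gt_three
  have hM0 : 0 ≤ M := by positivity
  have hk0 : 0 ≤ k := by positivity
  have hk1 : k ≤ 1 / 100000 := by
    rw [hkdef]
    have : L / Real.pi ≤ 1 := by rw [div_le_one hπ]; linarith
    nlinarith
  have hDr0 : 0 < 1 - Real.cos (2 * Real.pi * r / L) := lt_of_lt_of_le (by positivity) hDr
  -- facts on the closure of the outer domain
  have hcl : ∀ q ∈ closure {q : ℝ × ℝ | (∀ n : ℤ, r ^ 2 < (q.1 - n * L) ^ 2 + q.2 ^ 2) ∧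
      ∀ n : ℤ, ρ₀ ^ 2 < (q.1 - (n + 1 / 2) * L) ^ 2 + q.2 ^ 2},
      0 < rowD L q.1 q.2 ∧ s₀ ≤ Real.log (rowD L q.1 q.2) := by
    intro q hq
    have h1 := (exit_closure hL hr hrL hq).1
    exact ⟨lt_of_lt_of_le hDr0 h1, Real.log_le_log hDr0 h1⟩
  have hclV : closure {q : ℝ × ℝ | (∀ n : ℤ, r ^ 2 < (q.1 - n * L) ^ 2 + q.2 ^ 2) ∧
      ∀ n : ℤ, ρ₀ ^ 2 < (q.1 - (n + 1 / 2) * L) ^ 2 + q.2 ^ 2} ⊆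
      {q : ℝ × ℝ | 0 < rowD L q.1 q.2 ∧ Real.log (rowD L q.1 q.2) ∈ Ioi (s₀ - Λ)} := by
    intro q hq
    obtain ⟨h1, h2⟩ := hcl q hq
    exact ⟨h1, by simp only [mem_Ioi]; linarith⟩
  refine ⟨exitPhi L M Λ s₀ k, ?_, ?_, ?_, ?_, ?_, ?_⟩
  · exact (contDiffOn_exitPhi L M Λ s₀ k).mono (subset_closure.trans hclV)
  · exact ((contDiffOn_exitPhi L M Λ s₀ k (n := 0)).continuousOn).mono hclV
  · intro x y; exact exitPhi_periodic hL.ne' M Λ s₀ k x y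
  · intro q hq
    obtain ⟨h1, h2⟩ := hcl q hq
    exact exitPhi_nonneg hM0 hk0 (by linarith) h1 h2
  · intro q hq
    exact exitPhi_operator hL hL1 hρ₀ hρ₀L hν hr hνr hrL hq.1 hq.2
  · intro q hq
    obtain ⟨h1, h2⟩ := hcl q (subset_closure hq)
    have h3 := exitPhi_le hL hM0 hk0 hk1 hΛ hs₀ h1 h2
    calc exitPhi L M Λ s₀ k q.1 q.2 ≤ 3 * M * Λ * (1 + Real.log (1 + |q.2| / L)) := h3
      _ = 120000 * L ^ 2 / ρ₀ ^ 2 * Λ * (1 + Real.log (1 + |q.2| / L)) := by rw [hMdef]; ring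

end Summit.AnomalousDissipation.AnomalousDissipation.Theorems.MarginalStabilityChainStretchedVortexRows

end
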